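import Summits.Ventures.PercRepro.MSTightConjTCompletion
import Summits.Ventures.PercRepro.MSTightLost
import Summits.Ventures.PercRepro.MSTightKiller

/-!
# The lost differences of the completion `F̃ = F₀ ∪ (P + r)` — the mirror of Theorem 1

Dossier proofs/MINE1-theoremS.md, Addendum 48 §6 (the F̃-tight side of the normal form, by the
complementation symmetry of Theorem S's proof). Fix `r` and `F`, write `P = proj r F`,
`F₀ = part0 r F`, `F₁ = partr r F`, `P₀ = F₀ \ F₁` (the partnerless `r`-free members) and
`T = completion0 r F = F₀ ∪ (P + r)`. Then `F = T \ (P₀ + r)` (`completion0_sdiff_partnerless`),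
the `r`-free members of `T` are `F₀` and its `r`-members (with `r` removed) are all of `P`
(`part0_completion0`, `partr_completion0`); an `r`-difference `w ∪ {r}` of the tight twin-free `T`
is lost when `P₀ + r` is removed iff every member of the trace CONTAINING `w` is partnerless
(`insert_mem_lost_completion0_iff`, by the realisation from above `exists_sdiff_eq_of_subset`:
in a tight twin-free family a member `a ⊇ w` realises the difference `w` with
`b := (a ∪ R*) \ w`), and with a tight trace no `r`-free difference is lost
(`notMem_lost_completion0_of_notMem`, through p457834's `diffsY_subset_diffsX_of_tight_completion0`).
Hence `|D(F)| = |F| + (|P₀| − #{w ∈ diffsY r T : every trace member containing w lies in P₀})`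
(`card_diffs_eq_of_tight_completion0`) and excess one ⟺ that count is `|P₀| − 1`
(`excess_one_iff_of_tight_completion0`).
-/

namespace PercRepro.MSTight

open Finset
open scoped FinsetFamily

variable {α : Type*} [DecidableEq α] [Fintype α]

section Above

variable {P : Finset (Finset α)} (hP : Tight P) (htf : ∀ a b, Twin P a b → a = b)
include hP htf

/-- **Realisation from above.** In a tight twin-free family, a member `a` containing a
difference `w` realises it: `b := (a ∪ R*(P)) \ w` is a member with `a \ b = w`. -/
theorem exists_sdiff_eq_of_subset {w a : Finset α} (hw : w ∈ P \\ P) (ha : a ∈ P)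
    (hwa : w ⊆ a) : ∃ b ∈ P, a \ b = w := by
  have hD : IsDownSet (P \\ P) := isDownSet_diffs_of_twinFree hP htf
  obtain ⟨ha1, _⟩ := (mem_iff_parts hP).1 ha
  refine ⟨(a ∪ Rstar P) \ w, ?_, ?_⟩
  · rw [mem_iff_parts hP]
    constructor
    · refine hD _ ha1 _ ?_
      intro x hx
      simp only [mem_sdiff, mem_union] at hx
      simp only [mem_sdiff]
      tauto
    · refine hD _ hw _ ?_
      intro x hx
      simp only [mem_sdiff, mem_union, not_and, not_not] at hx
      exact hx.2 (Or.inr hx.1)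
  · ext x
    simp only [mem_sdiff, mem_union, not_and, not_not]
    constructor
    · rintro ⟨hxa, h⟩
      exact h (Or.inl hxa)
    · intro hxw
      exact ⟨hwa hxw, fun _ => hxw⟩

end Above

variable {r : α} {F : Finset (Finset α)}

section Parts

omit [Fintype α] in
/-- The `r`-free members of `completion0 r F` are exactly `F₀`. -/
theorem part0_completion0 : part0 r (completion0 r F) = part0 r F := by
  apply Subset.antisymm
  · intro A hA
    obtain ⟨hAT, hrA⟩ := mem_part0.1 hA
    rcases mem_union.1 hAT with h | h
    · exact h
    · obtain ⟨B, -, rfl⟩ := mem_image.1 h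
      exact absurd (mem_insert_self r B) hrA
  · exact part0_subset_part0_completion0

omit [Fintype α] in
/-- The `r`-members of `completion0 r F` (with `r` removed) are exactly the members of the
trace. -/
theorem partr_completion0 : partr r (completion0 r F) = proj r F := by
  apply Subset.antisymm
  · intro A hA
    obtain ⟨hrA, hAT⟩ := mem_partr.1 hA
    rcases mem_union.1 hAT with h | h
    · exact absurd (mem_insert_self r A) (mem_part0.1 h).2
    · obtain ⟨B, hB, hBA⟩ := mem_image.1 h
      have hrB : r ∉ B := notMem_of_mem_proj_completion hB
      have : B = A := by
        have h1 := congrArg (fun S => S.erase r) hBA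
        simp only [erase_insert hrB, erase_insert hrA] at h1
        exact h1
      rw [← this]; exact hB
  · exact proj_subset_partr_completion0

omit [Fintype α] in
/-- `F = completion0 r F \ (P₀ + r)`: removing the lifted partnerless `r`-free members from the
completion gives back `F`. -/
theorem completion0_sdiff_partnerless :
    completion0 r F \ (part0 r F \ partr r F).image (insert r) = F := by
  ext A
  simp only [mem_sdiff, mem_image, not_exists, not_and]
  by_cases hrA : r ∈ A
  · constructor
    · rintro ⟨hAT, h⟩
      rcases mem_union.1 hAT with h0 | h1
      · exact absurd hrA (mem_part0.1 h0).2
      · obtain ⟨B, hB, rfl⟩ := mem_image.1 h1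
        have hrB : r ∉ B := notMem_of_mem_proj_completion hB
        rw [proj_eq_union] at hB
        rcases mem_union.1 hB with hB0 | hB1
        · by_cases hB1 : B ∈ partr r F
          · exact (mem_partr.1 hB1).2
          · exact (h B ⟨hB0, hB1⟩ rfl).elim
        · exact (mem_partr.1 hB1).2
    · intro hA
      have hB : A.erase r ∈ partr r F := mem_partr.2 ⟨notMem_erase r A, by rw [insert_erase hrA]; exact hA⟩
      refine ⟨mem_union_right _ (mem_image.2 ⟨A.erase r, partr_subset_proj_completion hB,
        insert_erase hrA⟩), fun B hB' hBA => ?_⟩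
      have : B = A.erase r := by rw [← hBA, erase_insert (mem_part0.1 hB'.1).2]
      exact hB'.2 (this ▸ hB)
  · constructor
    · rintro ⟨hAT, -⟩
      have hA0 : A ∈ part0 r (completion0 r F) := mem_part0.2 ⟨hAT, hrA⟩
      rw [part0_completion0] at hA0
      exact (mem_part0.1 hA0).1
    · intro hA
      refine ⟨mem_union_left _ (mem_part0.2 ⟨hA, hrA⟩), fun B _ hBA => ?_⟩
      exact hrA (hBA ▸ mem_insert_self r B)

end Parts

section Lost

omit [Fintype α] in
/-- An `r`-difference `w ∪ {r}` of `T = completion0 r F` is lost when `P₀ + r` is removed as soon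
as every member of the trace containing `w` is partnerless (the definition of `lost`). -/
theorem insert_mem_lost_completion0_of_forall {w : Finset α} (hrw : r ∉ w)
    (hw : insert r w ∈ completion0 r F \\ completion0 r F)
    (hM : ∀ a ∈ proj r F, w ⊆ a → a ∈ part0 r F \ partr r F) :
    insert r w ∈ lost (completion0 r F) ((part0 r F \ partr r F).image (insert r)) := by
  rw [mem_lost]
  refine ⟨hw, fun a ha b hb hab => Or.inl ?_⟩
  have hra : r ∈ a := by
    have : r ∈ a \ b := by rw [hab]; exact mem_insert_self r w
    exact (mem_sdiff.1 this).1
  have haP : a.erase r ∈ proj r F := by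
    rw [← partr_completion0]
    exact mem_partr.2 ⟨notMem_erase r a, by rw [insert_erase hra]; exact ha⟩
  have hwa : w ⊆ a.erase r := by
    intro x hxw
    have hx : x ∈ a \ b := by rw [hab]; exact mem_insert_of_mem hxw
    exact mem_erase.2 ⟨fun hxr => hrw (hxr ▸ hxw), (mem_sdiff.1 hx).1⟩
  exact mem_image.2 ⟨a.erase r, hM _ haP hwa, insert_erase hra⟩

/-- **The mirror of Theorem 1 (i).** For a tight twin-free completion `T = completion0 r F`, an
`r`-difference `w ∪ {r}` of `T` is lost when `P₀ + r` is removed iff every member of the trace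
containing `w` is partnerless. -/
theorem insert_mem_lost_completion0_iff (hC : Tight (completion0 r F))
    (htf : ∀ a b, Twin (completion0 r F) a b → a = b) {w : Finset α} (hrw : r ∉ w)
    (hw : insert r w ∈ completion0 r F \\ completion0 r F) :
    insert r w ∈ lost (completion0 r F) ((part0 r F \ partr r F).image (insert r)) ↔
      ∀ a ∈ proj r F, w ⊆ a → a ∈ part0 r F \ partr r F := by
  constructor
  · intro hl a ha hwa
    have haT : insert r a ∈ completion0 r F := mem_union_right _ (mem_image_of_mem _ ha)
    have hra : r ∉ a := notMem_of_mem_proj_completion ha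
    have hsub : insert r w ⊆ insert r a := insert_subset_insert r hwa
    obtain ⟨b, hb, hab⟩ := exists_sdiff_eq_of_subset hC htf hw haT hsub
    rcases ((mem_lost.1 hl).2 _ haT b hb hab) with h | h
    · obtain ⟨a', ha', haa⟩ := mem_image.1 h
      have hra' : r ∉ a' := (mem_part0.1 (mem_sdiff.1 ha').1).2
      have : a' = a := by
        have h1 := congrArg (fun S => S.erase r) haa
        simp only [erase_insert hra', erase_insert hra] at h1
        exact h1
      rw [← this]; exact ha'
    · exfalso
      obtain ⟨b', hb', hbb⟩ := mem_image.1 h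
      have hrb : r ∈ b := hbb ▸ mem_insert_self r b'
      have : r ∈ insert r a \ b := by rw [hab]; exact mem_insert_self r w
      exact (mem_sdiff.1 this).2 hrb
  · exact insert_mem_lost_completion0_of_forall hrw hw

omit [Fintype α] in
/-- **The mirror of Theorem 1 (ii).** With a tight trace and a tight `completion0`, no `r`-free
difference of `completion0 r F` is lost when `P₀ + r` is removed (Conjecture (T) from a tight
`completion0`, p457834). -/
theorem notMem_lost_completion0_of_notMem (hP : Tight (proj r F)) (hC : Tight (completion0 r F))
    {w : Finset α} (hrw : r ∉ w) :
    w ∉ lost (completion0 r F) ((part0 r F \ partr r F).image (insert r)) := by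
  intro hl
  have hwT : w ∈ completion0 r F \\ completion0 r F := (mem_lost.1 hl).1
  have hwP : w ∈ proj r F \\ proj r F := by
    have h1 : w ∈ (completion0 r F \\ completion0 r F).filter (fun E => r ∉ E) :=
      mem_filter.2 ⟨hwT, hrw⟩
    rw [diffs_filter_notMem, diffsX, part0_completion0, partr_completion0] at h1
    rcases mem_union.1 h1 with h | h
    · rcases mem_union.1 h with h' | h'
      · exact diffs_subset part0_subset_proj_completion part0_subset_proj_completion h'
      · exact h'
    · exact diffs_subset_right part0_subset_proj_completion h
  have hwX : w ∈ diffsX r F := by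
    rw [diffs_proj_eq] at hwP
    rcases mem_union.1 hwP with h | h
    · exact h
    · exact diffsY_subset_diffsX_of_tight_completion0 hP hC h
  have hwF : w ∈ F \\ F := by
    rw [← diffs_filter_notMem] at hwX
    exact (mem_filter.1 hwX).1
  rw [← completion0_sdiff_partnerless (r := r) (F := F), diffs_sdiff_eq_diffs_sdiff_lost] at hwF
  exact (mem_sdiff.1 hwF).2 hl

/-- **The mirror of Theorem 1.** The lost differences of the tight twin-free `completion0 r F`
(with a tight trace) are exactly the sets `w ∪ {r}` with `w ∈ diffsY r T` such that every member
of the trace containing `w` is partnerless. -/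
theorem lost_completion0_eq (hP : Tight (proj r F)) (hC : Tight (completion0 r F))
    (htf : ∀ a b, Twin (completion0 r F) a b → a = b) :
    lost (completion0 r F) ((part0 r F \ partr r F).image (insert r)) =
      ((diffsY r (completion0 r F)).filter
        (fun w => ∀ a ∈ proj r F, w ⊆ a → a ∈ part0 r F \ partr r F)).image (insert r) := by
  ext E
  constructor
  · intro hE
    have hrE : r ∈ E := by
      by_contra hrE
      exact notMem_lost_completion0_of_notMem hP hC hrE hE
    have hET : E ∈ completion0 r F \\ completion0 r F := (mem_lost.1 hE).1
    have h1 : E ∈ (completion0 r F \\ completion0 r F).filter (fun E => r ∈ E) :=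
      mem_filter.2 ⟨hET, hrE⟩
    rw [diffs_filter_mem] at h1
    obtain ⟨w, hwY, rfl⟩ := mem_image.1 h1
    have hrw : r ∉ w := notMem_of_mem_diffsY hwY
    refine mem_image.2 ⟨w, mem_filter.2 ⟨hwY, ?_⟩, rfl⟩
    exact (insert_mem_lost_completion0_iff hC htf hrw hET).1 hE
  · intro hE
    obtain ⟨w, hw, rfl⟩ := mem_image.1 hE
    obtain ⟨hwY, hM⟩ := mem_filter.1 hw
    have hrw : r ∉ w := notMem_of_mem_diffsY hwY
    have hwT : insert r w ∈ completion0 r F \\ completion0 r F := by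
      have : insert r w ∈ (completion0 r F \\ completion0 r F).filter (fun E => r ∈ E) := by
        rw [diffs_filter_mem]; exact mem_image_of_mem _ hwY
      exact (mem_filter.1 this).1
    exact insert_mem_lost_completion0_of_forall hrw hwT hM

/-- The number of lost differences equals the number of `w ∈ diffsY r T` all of whose
trace members containing it are partnerless. -/
theorem card_lost_completion0 (hP : Tight (proj r F)) (hC : Tight (completion0 r F))
    (htf : ∀ a b, Twin (completion0 r F) a b → a = b) :
    (lost (completion0 r F) ((part0 r F \ partr r F).image (insert r))).card =
      ((diffsY r (completion0 r F)).filter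
        (fun w => ∀ a ∈ proj r F, w ⊆ a → a ∈ part0 r F \ partr r F)).card := by
  rw [lost_completion0_eq hP hC htf]
  apply card_image_of_injOn
  intro w hw w' hw' hww'
  have hrw : r ∉ w := notMem_of_mem_diffsY (mem_filter.1 hw).1
  have hrw' : r ∉ w' := notMem_of_mem_diffsY (mem_filter.1 hw').1
  have h := congrArg (fun S => S.erase r) hww'
  simp only [erase_insert hrw, erase_insert hrw'] at h
  exact h

omit [Fintype α] in
/-- `|P₀ + r| = |P₀|`. -/
theorem card_image_insert_partnerless :
    ((part0 r F \ partr r F).image (insert r)).card = (part0 r F \ partr r F).card := by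
  apply card_image_of_injOn
  intro s hs s' hs' hss'
  have hrs : r ∉ s := (mem_part0.1 (mem_sdiff.1 hs).1).2
  have hrs' : r ∉ s' := (mem_part0.1 (mem_sdiff.1 hs').1).2
  have h := congrArg (fun S => S.erase r) hss'
  simp only [erase_insert hrs, erase_insert hrs'] at h
  exact h

omit [Fintype α] in
/-- `P₀ + r ⊆ completion0 r F`. -/
theorem image_insert_partnerless_subset_completion0 :
    (part0 r F \ partr r F).image (insert r) ⊆ completion0 r F := by
  intro A hA
  obtain ⟨s, hs, rfl⟩ := mem_image.1 hA
  exact mem_union_right _ (mem_image_of_mem _ (part0_subset_proj_completion (mem_sdiff.1 hs).1))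

/-- **The excess of `F` in the F̃-tight normal form:** `|D(F)| = |F| + (|P₀| − #killed)` where
`#killed` counts the `w ∈ diffsY r T` all of whose trace members containing it are partnerless. -/
theorem card_diffs_eq_of_tight_completion0 (hP : Tight (proj r F))
    (hC : Tight (completion0 r F)) (htf : ∀ a b, Twin (completion0 r F) a b → a = b) :
    (F \\ F).card = F.card + ((part0 r F \ partr r F).card -
      ((diffsY r (completion0 r F)).filter
        (fun w => ∀ a ∈ proj r F, w ⊆ a → a ∈ part0 r F \ partr r F)).card) := by
  have h := card_diffs_sdiff_eq_of_tight hC (image_insert_partnerless_subset_completion0 (r := r) (F := F))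
  rw [completion0_sdiff_partnerless, card_lost_completion0 hP hC htf,
    card_image_insert_partnerless] at h
  exact h

/-- **Excess one in the F̃-tight normal form** ⟺ exactly `|P₀| − 1` of the `w ∈ diffsY r T` have
all their trace members containing them partnerless. -/
theorem excess_one_iff_of_tight_completion0 (hP : Tight (proj r F))
    (hC : Tight (completion0 r F)) (htf : ∀ a b, Twin (completion0 r F) a b → a = b) :
    (F \\ F).card = F.card + 1 ↔
      ((diffsY r (completion0 r F)).filter
        (fun w => ∀ a ∈ proj r F, w ⊆ a → a ∈ part0 r F \ partr r F)).card + 1 =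
        (part0 r F \ partr r F).card := by
  have h := card_diffs_sdiff_eq_succ_iff_of_tight hC
    (image_insert_partnerless_subset_completion0 (r := r) (F := F))
  rw [completion0_sdiff_partnerless, card_lost_completion0 hP hC htf,
    card_image_insert_partnerless] at h
  exact h

end Lost

end PercRepro.MSTight
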